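/-
Copyright (c) 2026. All rights reserved.
Released under Apache 2.0 license as described in the file LICENSE.
Authors: HodgeCM publication cell (pub-hodgecm), GR lane, seat GR-1 (`pub-hodgecm-own-real34`).
-/
import Literature.NumberTheory.Weil1964.ArchLeviSectionQuotientSign
import Literature.NumberTheory.Weil1964.ArchMetaplecticDoubleCoverHolds
import Literature.NumberTheory.Weil1964.ArchMetaplecticQuotientCharacter
import HarnessLib

/-!
# Conjugates of orthogonal Levi elements of `Mp^𝓢(W)` are orthogonal Levi elements ON THE NOSE

Topic `NumberTheory/Weil1964`; namespace `Literature.NumberTheory.Weil1964.MpS`.  KERNEL only: proved theorems; no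
definition, no `def … : Prop`, no named fact, no `sorry`.

For an orthogonal `r ∈ O_σ(ℝ)` the Levi element `m(r) := leviGL r = (m(r, r), f ↦ f ∘ rᵀ)` of Folland's `Mp^𝓢(W)`
(`W = ℝ^σ × ℝ^σ`) fixes the Gaussian vacuum `h₀` (`leviGL_apply_hermitePi_zero_of_orthogonal`) and has value-at-the-origin
scalar `1` (`leviGL_apply_zero_of_orthogonal`).  The point of this file:

* §1 **`apply_hermitePi_zero_apply_zero_ne_zero`** — for EVERY `y ∈ Mp^𝓢(W)` the function `y h₀` does not vanish at
  the origin: `y = c · m` with `m` metaplectic (Folland Thm. (4.37)), `m` is Gaussian-covariant (`m e^{πi x·ix} =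
  μ e^{πi x(g⋆i)x}`, `μ² j(g, i) = 1`, Folland Thm. (4.65)), and a Gaussian is `1` at `0`;
* §2 **`conj_leviGL_eq_leviGL_of_orthogonal`** — if `y ∈ Mp^𝓢(W)` conjugates the symplectic Levi element `m(r, r)` of an
  orthogonal `r` to that of an orthogonal `r'` (`π(y) m(r,r) π(y)⁻¹ = m(r',r')`), then
  `y · leviGL r · y⁻¹ = leviGL r'` IN `Mp^𝓢(W)` — no phase: by Schur the two sides differ by a unimodular `λ`, and
  applying both to `y h₀` and evaluating at `0` gives `(y h₀)(0) = λ (y h₀)(0)`, so `λ = 1` by §1.  In particular the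
  elements `leviGL r`, `r` a diagonal SIGN matrix (coordinate reflections, `r = rᵀ = r⁻¹`), are permuted among
  themselves by conjugation exactly as their images in `Sp(W)` are, and are centralised by every `y` over the
  centraliser of `m(r, r)`;
* §3 `leviGL_apply_zero_of_orthogonal`, **`conj_leviGL_apply_zero_of_orthogonal`** — hence the value at the origin of
  such a conjugate is `f ↦ f(0)`: `((y · leviGL r · y⁻¹) f)(0) = f(0)`.

Use (stage-1 cell `pub-hodgecm`, GR lane, [GelbartRogawski1991, Prop. 3.1.1] for a general quadratic `E/F`, `E` with
real places — type (ii)): the archimedean Weil section of the doubled unitary group at a real place of `F` split in `E`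
is a conjugated Levi section `x · leviGL(g_w) · x⁻¹` (`ArchRealSplitPlacesSection`); on the Levi sign representatives
`g_w = diag(ε, ε)` of the Siegel parabolic `P_Δ(E ⊗ ℝ)` modulo squares (`UnitaryGroupArchSiegelSquaresReps`) its value,
and the value of its conjugate by Weil's `r(δ)`, is therefore an orthogonal Levi element with origin value `1`
(`DoubledWeilRepresentationArchLiftReps`), which is what replaces the squares argument of the totally complex case.
[Folland1989, §4.2 (4.23)–(4.24), Thm. (4.37), §4.5 Thm. (4.65); Adams2007, §5 Rem. 5.6 (the `det^{1/2}` cover over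
`GL_n(ℝ)`).]

## References

* G. B. Folland, *Harmonic Analysis in Phase Space*, Princeton UP 1989, §4.2 (4.23)–(4.24), Thm. (4.37), §4.5
  (4.62), Thm. (4.65) [Folland1989].
* J. Adams, *The theta correspondence over ℝ*, in: Harmonic analysis, group representations, automorphic forms and
  invariant theory, World Scientific 2007, §5 Rem. 5.6 [Adams2007].
-/

set_option autoImplicit false

noncomputable section

open scoped Matrix Classical
open Matrix Complex
open Literature.RepresentationTheory.HeisenbergGroup
open Literature.RepresentationTheory.HeisenbergGroup.SymplecticMatrix
open Literature.Analysis.SegalBargmann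

namespace Literature.NumberTheory.Weil1964

namespace MpS

variable {σ : Type*} [Fintype σ] [DecidableEq σ]

/-! ## §1 `(y h₀)(0) ≠ 0` for every `y ∈ Mp^𝓢(W)` -/

omit [Fintype σ] [DecidableEq σ] in
/-- `cvec 0 = 0`. [cite: Folland1989, §4.5 (4.62)] -/
theorem cvec_zero : cvec (0 : σ → ℝ) = 0 := funext fun k => by rw [cvec_apply, Pi.zero_apply, Pi.zero_apply, ofReal_zero]

/-- a Gaussian is `1` at the origin: `gaussS τ 0 = 1` for `τ ∈ 𝔥_σ`. [cite: Folland1989, §4.5 (4.62)] -/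
theorem gaussS_apply_zero {τ : Matrix σ σ ℂ} (hτ : τ ∈ siegelH σ) : gaussS τ 0 = 1 := by
  rw [gaussS_apply hτ, gaussFun_apply, cvec_zero, zero_dotProduct, mul_zero, Complex.exp_zero]

/-- **the vacuum moved by any `y ∈ Mp^𝓢(W)` does not vanish at the origin**: `(y h₀)(0) ≠ 0` (`y = c · m`, `m`
metaplectic hence Gaussian-covariant: `m h₀ = 2^{n/4} μ e^{πi x(g⋆i1)x}` with `μ² j = 1`).
[cite: Folland1989, §4.2 Thm. (4.37), §4.5 Thm. (4.65)] -/
theorem apply_hermitePi_zero_apply_zero_ne_zero (y : MpS σ) : y.1.2 (hermitePi 0) 0 ≠ 0 := by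
  obtain ⟨c, hc, m, hm, -, rfl⟩ := exists_eq_unitScalar_mul_isMetaplectic y
  obtain ⟨μ, hμ, hμj⟩ := hm.isGaussCovariant (I • (1 : Matrix σ σ ℂ)) I_smul_one_mem_siegelH
  have hμ0 : μ ≠ 0 := by
    rintro rfl
    rw [zero_pow two_ne_zero, zero_mul] at hμj
    exact zero_ne_one hμj
  have hc0 : c ≠ 0 := by
    rintro rfl
    rw [norm_zero] at hc
    exact zero_ne_one hc
  have hv : ((vacCoef σ : ℝ) : ℂ) ≠ 0 := Complex.ofReal_ne_zero.2 (vacCoef_pos (σ := σ)).ne'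
  rw [mul_apply, unitScalar_apply, hermitePi_zero_eq_smul_gaussS, map_smul, hμ, _root_.smul_apply,
    _root_.smul_apply, _root_.smul_apply, gaussS_apply_zero (Sp.sact_mem _ I_smul_one_mem_siegelH),
    smul_eq_mul, smul_eq_mul, smul_eq_mul, mul_one]
  exact mul_ne_zero hc0 (mul_ne_zero hv hμ0)

/-! ## §2 Conjugating an orthogonal Levi element -/

omit [DecidableEq σ] in
/-- `(y⁻¹ (y f)) = f`. [cite: Folland1989, §4.2 (4.23)] -/
theorem inv_apply_apply (y : MpS σ) (f : SchwartzMap (σ → ℝ) ℂ) : (y⁻¹).1.2 (y.1.2 f) = f := by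
  rw [← mul_apply, inv_mul_cancel]
  rfl

/-- `|det r|^{-1/2} = 1` for an orthogonal `r`. [cite: Folland1989, §4.2 (4.24)] -/
theorem leviFactor_glEquiv_of_orthogonal (r : GL σ ℝ) (hr : (r : Matrix σ σ ℝ)ᵀ * (r : Matrix σ σ ℝ) = 1) :
    leviFactor (glEquiv r) = 1 := by
  have hdet : LinearMap.det ((glEquiv r : (σ → ℝ) ≃ₗ[ℝ] (σ → ℝ)) : (σ → ℝ) →ₗ[ℝ] (σ → ℝ)) = (r : Matrix σ σ ℝ).det := by
    rw [coe_glEquiv_eq_toLin', LinearMap.det_toLin']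
  rw [leviFactor, hdet, abs_det_eq_one_of_orthogonal _ hr, Real.one_rpow, Complex.ofReal_one]

/-- **the origin value of an orthogonal Levi element is `1`**: `(leviGL r f)(0) = f(0)` for `rᵀ r = 1`.
[cite: Folland1989, §4.2 (4.24)] -/
theorem leviGL_apply_zero_of_orthogonal (r : GL σ ℝ) (hr : (r : Matrix σ σ ℝ)ᵀ * (r : Matrix σ σ ℝ) = 1)
    (f : SchwartzMap (σ → ℝ) ℂ) : (leviGL r).1.2 f 0 = f 0 := by
  rw [leviGL_apply_snd, leviS_apply, leviFactor_glEquiv_of_orthogonal r hr, one_mul, map_zero]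

/-- **CONJUGATES OF ORTHOGONAL LEVI ELEMENTS, ON THE NOSE.**  If `y ∈ Mp^𝓢(W)` conjugates `m(r, r)` to `m(r', r')` in
`Sp(W)` for orthogonal `r, r'`, then `y · leviGL r · y⁻¹ = leviGL r'` in `Mp^𝓢(W)` (the unimodular Schur constant is `1`:
apply both sides to `y h₀`, which `leviGL r` fixes through `y`, and evaluate at the origin, where `y h₀ ≠ 0`).
[cite: Folland1989, §4.2 (4.23)–(4.24), Thm. (4.37); Adams2007, §5 Rem. 5.6] -/
theorem conj_leviGL_eq_leviGL_of_orthogonal (y : MpS σ) (r r' : GL σ ℝ)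
    (hr : (r : Matrix σ σ ℝ)ᵀ * (r : Matrix σ σ ℝ) = 1) (hr' : (r' : Matrix σ σ ℝ)ᵀ * (r' : Matrix σ σ ℝ) = 1)
    (h : proj y * proj (leviGL r) * (proj y)⁻¹ = proj (leviGL r')) :
    y * leviGL r * y⁻¹ = leviGL r' := by
  have hproj : proj (leviGL r') = proj (y * leviGL r * y⁻¹) := by rw [map_mul, map_mul, map_inv, h]
  obtain ⟨l, hl, hyl⟩ := exists_eq_unitScalar_mul_of_proj_eq hproj
  -- apply both sides to `φ := y h₀` and evaluate at `0`
  have h1 : (y * leviGL r * y⁻¹).1.2 (y.1.2 (hermitePi 0)) = y.1.2 (hermitePi 0) := by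
    rw [mul_apply, mul_apply, inv_apply_apply, leviGL_apply_hermitePi_zero_of_orthogonal r hr]
  have h2 : (unitScalar l hl * leviGL r').1.2 (y.1.2 (hermitePi 0)) 0 = l * y.1.2 (hermitePi 0) 0 := by
    rw [mul_apply, unitScalar_apply, _root_.smul_apply, smul_eq_mul, leviGL_apply_zero_of_orthogonal r' hr']
  have h3 : y.1.2 (hermitePi 0) 0 = l * y.1.2 (hermitePi 0) 0 := by
    rw [← h2, ← hyl, h1]
  have hl1 : l = 1 := by
    have h4 : (l - 1) * y.1.2 (hermitePi 0) 0 = 0 := by rw [sub_mul, one_mul, ← h3, sub_self]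
    rcases mul_eq_zero.1 h4 with h5 | h5
    · exact sub_eq_zero.1 h5
    · exact absurd h5 (apply_hermitePi_zero_apply_zero_ne_zero y)
  subst hl1
  rw [hyl]
  refine ext' (by rw [map_mul, proj_unitScalar, one_mul]) fun f => ?_
  rw [mul_apply, unitScalar_apply, one_smul]

/-- in particular `y` over the CENTRALISER of `m(r, r)` centralises `leviGL r` (`r` orthogonal).
[cite: Folland1989, §4.2 (4.23)–(4.24), Thm. (4.37)] -/
theorem conj_leviGL_eq_self_of_orthogonal (y : MpS σ) (r : GL σ ℝ) (hr : (r : Matrix σ σ ℝ)ᵀ * (r : Matrix σ σ ℝ) = 1)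
    (h : proj y * proj (leviGL r) = proj (leviGL r) * proj y) : y * leviGL r * y⁻¹ = leviGL r :=
  conj_leviGL_eq_leviGL_of_orthogonal y r r hr hr (by rw [h, mul_inv_cancel_right])

/-! ## §3 The value at the origin of such a conjugate -/

/-- **the origin value of a conjugate of an orthogonal Levi element is `1`**: under the hypothesis of
`conj_leviGL_eq_leviGL_of_orthogonal`, `((y · leviGL r · y⁻¹) f)(0) = f(0)` for every `f ∈ 𝓢(ℝ^σ)`.
[cite: Folland1989, §4.2 (4.24), Thm. (4.37)] -/
theorem conj_leviGL_apply_zero_of_orthogonal (y : MpS σ) (r r' : GL σ ℝ)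
    (hr : (r : Matrix σ σ ℝ)ᵀ * (r : Matrix σ σ ℝ) = 1) (hr' : (r' : Matrix σ σ ℝ)ᵀ * (r' : Matrix σ σ ℝ) = 1)
    (h : proj y * proj (leviGL r) * (proj y)⁻¹ = proj (leviGL r')) (f : SchwartzMap (σ → ℝ) ℂ) :
    (y * leviGL r * y⁻¹).1.2 f 0 = 1 * f 0 := by
  rw [conj_leviGL_eq_leviGL_of_orthogonal y r r' hr hr' h, leviGL_apply_zero_of_orthogonal r' hr', one_mul]

/-- iterated form (two conjugations, as met in the doubling method: the section's own Cayley conjugation, then Weil's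
`r(δ)`): `((z · (x · leviGL r · x⁻¹) · z⁻¹) f)(0) = f(0)` whenever `π(z x)` conjugates `m(r, r)` to some `m(r', r')`,
`r, r'` orthogonal. [cite: Folland1989, §4.2 (4.24), Thm. (4.37)] -/
theorem conj_conj_leviGL_apply_zero_of_orthogonal (z x : MpS σ) (r r' : GL σ ℝ)
    (hr : (r : Matrix σ σ ℝ)ᵀ * (r : Matrix σ σ ℝ) = 1) (hr' : (r' : Matrix σ σ ℝ)ᵀ * (r' : Matrix σ σ ℝ) = 1)
    (h : proj (z * x) * proj (leviGL r) * (proj (z * x))⁻¹ = proj (leviGL r')) (f : SchwartzMap (σ → ℝ) ℂ) :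
    (z * (x * leviGL r * x⁻¹) * z⁻¹).1.2 f 0 = 1 * f 0 := by
  have hzx : z * (x * leviGL r * x⁻¹) * z⁻¹ = (z * x) * leviGL r * (z * x)⁻¹ := by group
  rw [hzx]
  exact conj_leviGL_apply_zero_of_orthogonal (z * x) r r' hr hr' h f

end MpS

end Literature.NumberTheory.Weil1964

end
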